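import Summits.CriticalPhenomena.PercolationContinuityZ3.Theses.PercNearOneGluing
import Summits.CriticalPhenomena.PercolationContinuityZ3.Theorems.PercNearOneGluingAdditiveGluingSuffices
import Summits.CriticalPhenomena.PercolationContinuityZ3.Theorems.PercNearOneGluingNoHeavyLowerTailResidualOfNearOneGluing
import Summits.CriticalPhenomena.PercolationContinuityZ3.Theorems.PercNearOneGluingNoHeavyLowerTailReduction
import Literature.Probability.Percolation.PercolationProofs
import Literature.Probability.LatticeModels.ProdBernoulliIndependence
import HarnessLib

/-!
# Crux `PercNearOneGluing.NoHeavyLowerTail` (stmt-CriticalPhenomena-4575), line `comonotone-deadzone` —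
# the REDUCTION: comonotone dead-zone domination ⇒ hub gluing with constant one ⇒ `AdditiveGluing` ⇒ crux

Prover `prover-rtask-CriticalPhenomena-PercNearOneG-529c20ca-0` (strategy (a), domination), 2026-08-17.
Lands with `--supports stmt-CriticalPhenomena-4575`; this is the sorry-free content of the registered
skeleton of the line (stub `stub_comonotoneDeadZone`), with the one stub turned into a hypothesis.

Notation: `μ = prodBernoulli w` on bond configurations of the complete graph on `Fin n`, relay set `A`,
observer `o`, target `b`, unreliability `u(v) = μ(v ↮ b)`.

* The hypothesis (S2, "comonotone dead-zone domination"; the bottleneck / layer-cake strengthening of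
  least-reliable-first, sibling crux 4574):
  `μ(o ↔ A, o ↮ b) ≤ ∫₀¹ μ(o ↔ A inside {v | t ≤ u(v)} ∪ {o}) dt` on every finite weighted graph.
  The right-hand side is `E[g(L_τ)]`, `g(S) = μ(o ↔ A inside S)`, for the level-set process
  `L_τ = {u ≥ τ} ∪ {o}`, `τ ~ U[0,1]` — the comonotone rearrangement of the dead zone `V ∖ C(b)`, whose
  un-rearranged average `E[1{o ∉ C(b)} g(V ∖ C(b))]` IS the left-hand side (spatial Markov property).
* `deadZoneLevelIntegral_le` — THE EXTREMAL COMPUTATION: if `u ≤ δ` on `A` and `o ∉ A` then the level set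
  `{u ≥ t} ∪ {o}` misses `A` for `t > δ`, the integrand vanishes there, and the integral is `≤ δ`.
* `hubGluing_of_comonotoneDeadZone` — hence S2 gives `μ(o ↔ A, o ↮ b) ≤ max_{a ∈ A} μ(a ↮ b)` (constant ONE).
* `additiveGluing_of_comonotoneDeadZone` — hence `AdditiveGluing` (item 4576's statement).
* `noHeavyLowerTail_of_comonotoneDeadZone` — hence the crux, through the landed glue
  `additiveGluingSuffices_proof`, `manyFingersLargePocket_of_nearOneGluing`,
  `noHeavyLowerTail_of_manyFingersLargePocket`.
-/

namespace Summit.CriticalPhenomena.PercolationContinuityZ3.Theorems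

open MeasureTheory Set Literature.Probability.LatticeModels Literature.Probability.Percolation
open Summit.CriticalPhenomena.PercolationContinuityZ3.Theses.PercNearOneGluing
open scoped Classical BigOperators

section ComonotoneDeadZone

variable {n : ℕ}

/-- The level-set connection profile `t ↦ μ(o ↔ A inside {v | t ≤ μ(v ↮ b)} ∪ {o})` is antitone in the
threshold (level sets shrink as `t` grows). [folklore] -/
theorem deadZoneLevelProfile_antitone (w : Sym2 (Fin n) → unitInterval) (A : Finset (Fin n)) (o b : Fin n) :
    Antitone fun t : ℝ => (prodBernoulli w).real
      (⋃ a ∈ A, openConnIn ({v : Fin n | t ≤ (prodBernoulli w).real (openConn v b)ᶜ} ∪ {o}) o a) := by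
  intro s t hst
  have hsub : ({v : Fin n | t ≤ (prodBernoulli w).real (openConn v b)ᶜ} ∪ {o}) ⊆
      ({v : Fin n | s ≤ (prodBernoulli w).real (openConn v b)ᶜ} ∪ {o}) :=
    Set.union_subset_union_left _ fun v (hv : t ≤ _) => le_trans hst hv
  refine measureReal_mono (Set.iUnion₂_mono fun a _ => ?_) (measure_ne_top _ _)
  rintro ω ⟨hx, hy, hr⟩
  exact ⟨hsub hx, hsub hy, hr.map (SimpleGraph.induceHomOfLE (G := openGraph ω) hsub).toHom⟩

/-- Above the worst relay unreliability the level set `{u ≥ t} ∪ {o}` misses `A` (`o ∉ A`), so the level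
profile vanishes: an open path inside a set ends in that set. [folklore] -/
theorem deadZoneLevelProfile_eq_zero (w : Sym2 (Fin n) → unitInterval) (A : Finset (Fin n)) (o b : Fin n)
    (ho : o ∉ A) {δ t : ℝ} (hA : ∀ a ∈ A, (prodBernoulli w).real (openConn a b)ᶜ ≤ δ) (ht : δ < t) :
    (prodBernoulli w).real
      (⋃ a ∈ A, openConnIn ({v : Fin n | t ≤ (prodBernoulli w).real (openConn v b)ᶜ} ∪ {o}) o a) = 0 := by
  have hempty : (⋃ a ∈ A, openConnIn
      ({v : Fin n | t ≤ (prodBernoulli w).real (openConn v b)ᶜ} ∪ {o}) o a) =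
        (∅ : Set (BondConfig (Fin n))) := by
    refine Set.eq_empty_of_forall_notMem fun ω hω => ?_
    rw [Set.mem_iUnion₂] at hω
    obtain ⟨a, ha, _, hmem, _⟩ := hω
    rcases hmem with hle | hao
    · exact absurd (lt_of_lt_of_le ht (le_trans hle (hA a ha))) (lt_irrefl _)
    · exact ho (by rw [Set.mem_singleton_iff] at hao; rwa [hao] at ha)
  rw [hempty, measureReal_empty]

/-- **The extremal computation.** If every relay is `δ`-reliable (`μ(a ↮ b) ≤ δ` on `A`, `0 ≤ δ`) and
`o ∉ A`, then `∫₀¹ μ(o ↔ A inside {u ≥ t} ∪ {o}) dt ≤ δ`: the integrand is at most `1` on `(0, δ]` and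
vanishes on `(δ, 1]`. [folklore] -/
theorem deadZoneLevelIntegral_le (w : Sym2 (Fin n) → unitInterval) (A : Finset (Fin n)) (o b : Fin n)
    (ho : o ∉ A) {δ : ℝ} (hδ : 0 ≤ δ) (hA : ∀ a ∈ A, (prodBernoulli w).real (openConn a b)ᶜ ≤ δ) :
    ∫ t in (0 : ℝ)..1, (prodBernoulli w).real
        (⋃ a ∈ A, openConnIn ({v : Fin n | t ≤ (prodBernoulli w).real (openConn v b)ᶜ} ∪ {o}) o a) ≤ δ := by
  set f : ℝ → ℝ := fun t => (prodBernoulli w).real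
      (⋃ a ∈ A, openConnIn ({v : Fin n | t ≤ (prodBernoulli w).real (openConn v b)ᶜ} ∪ {o}) o a) with hf
  have hanti : Antitone f := deadZoneLevelProfile_antitone w A o b
  have hle1 : ∀ t, f t ≤ 1 := fun t => measureReal_le_one
  have hint : ∀ x y : ℝ, IntervalIntegrable f volume x y :=
    fun x y => (hanti.antitoneOn _).intervalIntegrable
  show ∫ t in (0 : ℝ)..1, f t ≤ δ
  by_cases hδ1 : 1 ≤ δ
  · calc ∫ t in (0 : ℝ)..1, f t
        ≤ ∫ _ in (0 : ℝ)..1, (1 : ℝ) :=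
          intervalIntegral.integral_mono_on zero_le_one (hint 0 1) (by simp) fun t _ => hle1 t
      _ = 1 := by simp
      _ ≤ δ := hδ1
  · push Not at hδ1
    have hsplit : ∫ t in (0 : ℝ)..1, f t = (∫ t in (0 : ℝ)..δ, f t) + ∫ t in δ..1, f t :=
      (intervalIntegral.integral_add_adjacent_intervals (hint 0 δ) (hint δ 1)).symm
    have h1 : ∫ t in (0 : ℝ)..δ, f t ≤ δ := by
      calc ∫ t in (0 : ℝ)..δ, f t
          ≤ ∫ _ in (0 : ℝ)..δ, (1 : ℝ) :=
            intervalIntegral.integral_mono_on hδ (hint 0 δ) (by simp) fun t _ => hle1 t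
        _ = δ := by simp
    have h2 : ∫ t in δ..1, f t = 0 := by
      have hae : ∀ᵐ t ∂(volume : Measure ℝ), t ∈ Set.uIoc δ 1 → f t = (fun _ => (0 : ℝ)) t := by
        refine Filter.Eventually.of_forall fun t ht => ?_
        rw [Set.uIoc_of_le hδ1.le] at ht
        exact deadZoneLevelProfile_eq_zero w A o b ho hA ht.1
      rw [intervalIntegral.integral_congr_ae hae]
      simp
    rw [hsplit, h2, add_zero]
    exact h1

/-- **Hub gluing with constant one from comonotone dead-zone domination.**  If
`μ(o ↔ A, o ↮ b) ≤ ∫₀¹ μ(o ↔ A inside {u ≥ t} ∪ {o}) dt` holds on every finite weighted graph (S2), then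
`μ(o ↔ A, o ↮ b) ≤ δ` whenever `o ∉ A` and every relay has `μ(a ↮ b) ≤ δ`. [folklore] -/
theorem hubGluing_of_comonotoneDeadZone
    (hS2 : ∀ (n : ℕ) (w : Sym2 (Fin n) → unitInterval) (A : Finset (Fin n)) (o b : Fin n),
      (prodBernoulli w).real ((⋃ a ∈ A, openConn o a) ∩ (openConn o b)ᶜ) ≤
        ∫ t in (0 : ℝ)..1, (prodBernoulli w).real
          (⋃ a ∈ A, openConnIn ({v : Fin n | t ≤ (prodBernoulli w).real (openConn v b)ᶜ} ∪ {o}) o a))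
    (w : Sym2 (Fin n) → unitInterval) (A : Finset (Fin n)) (o b : Fin n)
    (ho : o ∉ A) {δ : ℝ} (hδ : 0 ≤ δ) (hA : ∀ a ∈ A, (prodBernoulli w).real (openConn a b)ᶜ ≤ δ) :
    (prodBernoulli w).real ((⋃ a ∈ A, openConn o a) ∩ (openConn o b)ᶜ) ≤ δ :=
  le_trans (hS2 n w A o b) (deadZoneLevelIntegral_le w A o b ho hδ hA)

end ComonotoneDeadZone

/-- **Comonotone dead-zone domination gives `AdditiveGluing`** (item 4576's statement):
`μ(o ↔ A) − t ≤ μ(o ↔ b)` whenever `1 − t ≤ μ(a ↔ b)` on `A`.  If `o ∈ A` this is the hypothesis at `o`;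
otherwise `μ(o ↔ A) − μ(o ↔ b) ≤ μ(o ↔ A, o ↮ b) ≤ t` by `hubGluing_of_comonotoneDeadZone`. [folklore] -/
theorem additiveGluing_of_comonotoneDeadZone
    (hS2 : ∀ (n : ℕ) (w : Sym2 (Fin n) → unitInterval) (A : Finset (Fin n)) (o b : Fin n),
      (prodBernoulli w).real ((⋃ a ∈ A, openConn o a) ∩ (openConn o b)ᶜ) ≤
        ∫ t in (0 : ℝ)..1, (prodBernoulli w).real
          (⋃ a ∈ A, openConnIn ({v : Fin n | t ≤ (prodBernoulli w).real (openConn v b)ᶜ} ∪ {o}) o a)) :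
    AdditiveGluing := by
  intro n w A o b t ht hA
  set μ := prodBernoulli w with hμ
  have hA' : ∀ a ∈ A, μ.real (openConn a b)ᶜ ≤ t := by
    intro a ha
    have h1 := hA a ha
    have hc : μ.real (openConn a b)ᶜ = 1 - μ.real (openConn a b) := by
      rw [measureReal_compl (measurableSet_openConn_holds a b), probReal_univ]
    rw [hc]; linarith
  by_cases ho : o ∈ A
  · have h1 := hA o ho
    linarith [measureReal_le_one (μ := μ) (s := ⋃ a ∈ A, openConn o a)]
  · have hbad := hubGluing_of_comonotoneDeadZone hS2 w A o b ho ht hA'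
    have hsplit : μ.real (⋃ a ∈ A, openConn o a) ≤
        μ.real ((⋃ a ∈ A, openConn o a) ∩ (openConn o b)ᶜ) + μ.real (openConn o b) := by
      calc μ.real (⋃ a ∈ A, openConn o a)
          ≤ μ.real (((⋃ a ∈ A, openConn o a) ∩ (openConn o b)ᶜ) ∪ openConn o b) := by
            refine measureReal_mono (fun ω hω => ?_) (measure_ne_top _ _)
            by_cases hb : ω ∈ openConn o b
            · exact Or.inr hb
            · exact Or.inl ⟨hω, hb⟩
        _ ≤ μ.real ((⋃ a ∈ A, openConn o a) ∩ (openConn o b)ᶜ) + μ.real (openConn o b) :=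
            measureReal_union_le _ _
    linarith

/-- **The reduction of the line `comonotone-deadzone`**: comonotone dead-zone domination (S2) implies the
crux `NoHeavyLowerTail` (S2 ⇒ hub gluing with constant one ⇒ `AdditiveGluing` ⇒ `NearOneGluing` with
`δ = ε/2` ⇒ many-fingers residual ⇒ crux, the last three by landed glue). [folklore] -/
theorem noHeavyLowerTail_of_comonotoneDeadZone : (∀ (n : ℕ) (w : Sym2 (Fin n) → unitInterval) (A : Finset (Fin n)) (o b : Fin n), (Literature.Probability.LatticeModels.prodBernoulli w).real ((⋃ a ∈ A, Literature.Probability.Percolation.openConn o a) ∩ (Literature.Probability.Percolation.openConn o b)ᶜ) ≤ ∫ t in (0 : ℝ)..1, (Literature.Probability.LatticeModels.prodBernoulli w).real (⋃ a ∈ A, Literature.Probability.Percolation.openConnIn ({v : Fin n | t ≤ (Literature.Probability.LatticeModels.prodBernoulli w).real (Literature.Probability.Percolation.openConn v b)ᶜ} ∪ {o}) o a)) → Summit.CriticalPhenomena.PercolationContinuityZ3.Theses.PercNearOneGluing.NoHeavyLowerTail := fun hS2 =>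
  noHeavyLowerTail_of_manyFingersLargePocket
    (manyFingersLargePocket_of_nearOneGluing
      (additiveGluingSuffices_proof (additiveGluing_of_comonotoneDeadZone hS2)))


/-! ## The weakest domination statement that closes the crux

The crux only needs that a SMALL level-set integral forces a small bad probability, uniformly:
`∀ ε > 0 ∃ η > 0 ∀ (n, w, A, o, b), ∫₀¹ μ(o ↔ A inside {u ≥ t} ∪ {o}) dt ≤ η → μ(o ↔ A, o ↮ b) ≤ ε`
(implied by S2 with `η = ε`, and by S2 up to any multiplicative constant).  Registered as
`stub_comonotoneDeadZoneWeak`; its reduction to the crux is `noHeavyLowerTail_of_comonotoneDeadZoneWeak`. -/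

/-- **Weak comonotone dead-zone domination gives `NearOneGluing`.**  Given `ε`, take `η` from the
hypothesis at `ε/2` and `δ = min η (ε/2)`: if every relay is `δ`-reliable then the level-set integral is
`≤ δ ≤ η` (`deadZoneLevelIntegral_le`), so `μ(o ↔ A, o ↮ b) ≤ ε/2` and
`μ(o ↮ b) ≤ μ(o ↮ A) + μ(o ↔ A, o ↮ b) < δ + ε/2 ≤ ε`. [folklore] -/
theorem nearOneGluing_of_comonotoneDeadZoneWeak
    (hW : ∀ ε : ℝ, 0 < ε → ∃ η : ℝ, 0 < η ∧ ∀ (n : ℕ) (w : Sym2 (Fin n) → unitInterval)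
      (A : Finset (Fin n)) (o b : Fin n),
      ∫ t in (0 : ℝ)..1, (prodBernoulli w).real
          (⋃ a ∈ A, openConnIn ({v : Fin n | t ≤ (prodBernoulli w).real (openConn v b)ᶜ} ∪ {o}) o a) ≤ η →
        (prodBernoulli w).real ((⋃ a ∈ A, openConn o a) ∩ (openConn o b)ᶜ) ≤ ε) :
    NearOneGluing := by
  intro ε hε
  obtain ⟨η, hη, hWη⟩ := hW (ε / 2) (by linarith)
  refine ⟨min η (ε / 2), lt_min hη (by linarith), ?_⟩
  intro n w A o b hH1 hH2
  set μ := prodBernoulli w with hμ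
  set δ := min η (ε / 2) with hδ
  have hδη : δ ≤ η := min_le_left _ _
  have hδε : δ ≤ ε / 2 := min_le_right _ _
  have hδ0 : 0 ≤ δ := le_of_lt (lt_min hη (by linarith))
  by_cases ho : o ∈ A
  · have h1 := hH2 o ho
    linarith
  · -- unreliability of each relay is at most `δ`
    have hA' : ∀ a ∈ A, μ.real (openConn a b)ᶜ ≤ δ := by
      intro a ha
      have h1 := hH2 a ha
      have hc : μ.real (openConn a b)ᶜ = 1 - μ.real (openConn a b) := by
        rw [measureReal_compl (measurableSet_openConn_holds a b), probReal_univ]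
      rw [hc]; linarith
    have hint : ∫ t in (0 : ℝ)..1, μ.real
        (⋃ a ∈ A, openConnIn ({v : Fin n | t ≤ μ.real (openConn v b)ᶜ} ∪ {o}) o a) ≤ η :=
      le_trans (deadZoneLevelIntegral_le w A o b ho hδ0 hA') hδη
    have hbad : μ.real ((⋃ a ∈ A, openConn o a) ∩ (openConn o b)ᶜ) ≤ ε / 2 := hWη n w A o b hint
    have hsplit : μ.real (⋃ a ∈ A, openConn o a) ≤
        μ.real ((⋃ a ∈ A, openConn o a) ∩ (openConn o b)ᶜ) + μ.real (openConn o b) := by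
      calc μ.real (⋃ a ∈ A, openConn o a)
          ≤ μ.real (((⋃ a ∈ A, openConn o a) ∩ (openConn o b)ᶜ) ∪ openConn o b) := by
            refine measureReal_mono (fun ω hω => ?_) (measure_ne_top _ _)
            by_cases hb : ω ∈ openConn o b
            · exact Or.inr hb
            · exact Or.inl ⟨hω, hb⟩
        _ ≤ μ.real ((⋃ a ∈ A, openConn o a) ∩ (openConn o b)ᶜ) + μ.real (openConn o b) :=
            measureReal_union_le _ _
    linarith

/-- **The reduction of the weakest domination form**: `stub_comonotoneDeadZoneWeak` implies the crux
`NoHeavyLowerTail` (weak domination ⇒ `NearOneGluing` ⇒ many-fingers residual ⇒ crux). [folklore] -/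
theorem noHeavyLowerTail_of_comonotoneDeadZoneWeak : (∀ ε : ℝ, 0 < ε → ∃ η : ℝ, 0 < η ∧ ∀ (n : ℕ) (w : Sym2 (Fin n) → unitInterval) (A : Finset (Fin n)) (o b : Fin n), ∫ t in (0 : ℝ)..1, (Literature.Probability.LatticeModels.prodBernoulli w).real (⋃ a ∈ A, Literature.Probability.Percolation.openConnIn ({v : Fin n | t ≤ (Literature.Probability.LatticeModels.prodBernoulli w).real (Literature.Probability.Percolation.openConn v b)ᶜ} ∪ {o}) o a) ≤ η → (Literature.Probability.LatticeModels.prodBernoulli w).real ((⋃ a ∈ A, Literature.Probability.Percolation.openConn o a) ∩ (Literature.Probability.Percolation.openConn o b)ᶜ) ≤ ε) → Summit.CriticalPhenomena.PercolationContinuityZ3.Theses.PercNearOneGluing.NoHeavyLowerTail := fun hW =>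
  noHeavyLowerTail_of_manyFingersLargePocket
    (manyFingersLargePocket_of_nearOneGluing (nearOneGluing_of_comonotoneDeadZoneWeak hW))

/-- S2 implies its weak form (with `η = ε`). [folklore] -/
theorem comonotoneDeadZoneWeak_of_comonotoneDeadZone
    (hS2 : ∀ (n : ℕ) (w : Sym2 (Fin n) → unitInterval) (A : Finset (Fin n)) (o b : Fin n),
      (prodBernoulli w).real ((⋃ a ∈ A, openConn o a) ∩ (openConn o b)ᶜ) ≤
        ∫ t in (0 : ℝ)..1, (prodBernoulli w).real
          (⋃ a ∈ A, openConnIn ({v : Fin n | t ≤ (prodBernoulli w).real (openConn v b)ᶜ} ∪ {o}) o a)) :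
    ∀ ε : ℝ, 0 < ε → ∃ η : ℝ, 0 < η ∧ ∀ (n : ℕ) (w : Sym2 (Fin n) → unitInterval)
      (A : Finset (Fin n)) (o b : Fin n),
      ∫ t in (0 : ℝ)..1, (prodBernoulli w).real
          (⋃ a ∈ A, openConnIn ({v : Fin n | t ≤ (prodBernoulli w).real (openConn v b)ᶜ} ∪ {o}) o a) ≤ η →
        (prodBernoulli w).real ((⋃ a ∈ A, openConn o a) ∩ (openConn o b)ᶜ) ≤ ε :=
  fun ε hε => ⟨ε, hε, fun n w A o b hint => le_trans (hS2 n w A o b) hint⟩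

end Summit.CriticalPhenomena.PercolationContinuityZ3.Theorems
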